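import Mathlib
import Literature.Combinatorics.Additive.TripleProductProperty
import Summits.MatrixMultiplication.MatrixMultiplication.Theorems.SnSubsetDichotomyHyperoctahedralSubsetsGroupPacking

/-!
# Clique packing: the clique–coclique duality behind the hosted packing bounds
(crux `HyperoctahedralThreshold`, stmt-MatrixMultiplication-10883, refutation line, lead c4 — certificate track)

Let `P` be a group, `C₀, C₁, C₂ ⊆ P` finite "hosts" closed under `(a, b) ↦ a⁻¹ b`, and
`X_i ⊆ C_i` a triple with the triple product property (tree convention
`Literature.Combinatorics.Additive.TripleProductProperty`:
`s s'⁻¹ (t t'⁻¹) (u u'⁻¹) = 1 ⇒ s = s' ∧ t = t' ∧ u = u'`).  Write, for triples `k = (a, b, c)` and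
`k' = (a', b', c')`, `rel k k' :⇔ a a'⁻¹ (b b'⁻¹) (c c'⁻¹) = 1` — the relation the triple product
property forbids between distinct points of `X₀ × X₁ × X₂`; it is invariant under simultaneous RIGHT
translation of both triples.  A **clique** is a finite family `K` of hosted triples
(`a ∈ C₀, b ∈ C₁, c ∈ C₂`) any two distinct members of which are related IN AT LEAST ONE ORDER
(`rel k k' ∨ rel k' k`).  Then

  `|X₀| · |X₁| · |X₂| · |K| ≤ |C₀| · |C₁| · |C₂|`            (`card_mul_card_le_of_tpp_of_clique`).

Proof: the map `(k, x) ↦ k⁻¹ x = (a⁻¹ x₀, b⁻¹ x₁, c⁻¹ x₂)` from `K × (X₀ × X₁ × X₂)` to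
`C₀ × C₁ × C₂` is injective — if `k⁻¹ x = k'⁻¹ x'` with `k ≠ k'` then `x = k g`, `x' = k' g` for one
`g`, so `rel x x' = rel k k'` and `rel x' x = rel k' k` (right invariance); one of them holds, and the
triple product property gives `x = x'`, whence `k = k'`.  So `|K| · vol ≤ |C₀||C₁||C₂|`
(`Finset.card_le_card_of_injOn`).  This is the clique–coclique bound `α · ω ≤ |Ω|` for the
right-invariant graph on `Ω = C₀ × C₁ × C₂`; a TPP triple is a product coclique.

It contains the tree's GROUP packing (`…HyperoctahedralSubsets.card_mul_card_le_of_tpp_of_hosted`,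
p74548: `T` a group of hosted triples with `abc = 1`) as the special case "`K` a subgroup": for
`k, k' ∈ T`, `k k'⁻¹ ∈ T` has product one, which is that relation (`clique_of_group`).  It is strictly
more general: no group structure, no normalisation `abc = 1`, no support-disjointness and only ONE of
the two orders per pair is required (e.g. `{(a, a⁻¹, 1)} ∪ {(1, b, b⁻¹)} ∪ {(c, 1, c⁻¹)}` over abelian
parts of the pairwise host intersections is a clique but not a group; at `n = 6` the `K₃,₃`
one-factorisation has clique number `9` while every hosted diagonal group has order `≤ 8`).  A clique is
a kilobyte-size, `decide`-checkable certificate for "every TPP triple hosted by `(C₀, C₁, C₂)` has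
volume `≤ |C₀||C₁||C₂| / |K|`" (`vol_le_div_of_clique`), the cheap dual of the LRAT volume census
(`Theorems/HyperoctahedralThreshold/Negative/HostedTPPSAT.lean`).

The hyperoctahedral specialisation (`clique_packing`): `μ₀, μ₁, μ₂` permutations of `Fin n`,
`C(μ_i) = univ.filter (σ * μ i = μ i * σ)`, `X_i ⊆ C(μ_i)` TPP, `K` a clique of hosted triples ⇒
`|X₀||X₁||X₂| · |K| ≤ |C(μ₀)||C(μ₁)||C(μ₂)|`.  No involution / fixed-point-freeness hypothesis is used.

References: H. Cohn, C. Umans, FOCS 2003, Lemma 3.1 (`K = 1`); the clique–coclique bound for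
vertex-transitive graphs is folklore (e.g. Godsil–Meagher, *Erdős–Ko–Rado theorems: algebraic
approaches*, CUP 2015, Cor. 2.1.2 / Lemma 7.2.1); the 3-wise group case is the sibling line's p74548.
-/

set_option linter.dupNamespace false

namespace Summit.MatrixMultiplication.MatrixMultiplication.Theorems.HyperoctahedralThreshold

namespace CliquePacking

open Literature.Combinatorics.Additive

variable {P : Type*} [Group P]

/-- The forbidden relation `a a'⁻¹ (b b'⁻¹) (c c'⁻¹) = 1` between triples `k = (a,b,c)`,
`k' = (a',b',c')` is invariant under simultaneous right translation `k ↦ k g`, `k' ↦ k' g`. [folklore] -/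
theorem rel_mul_right (k k' g : P × P × P) :
    (k * g).1 * (k' * g).1⁻¹ * ((k * g).2.1 * (k' * g).2.1⁻¹) * ((k * g).2.2 * (k' * g).2.2⁻¹) = 1 ↔
      k.1 * k'.1⁻¹ * (k.2.1 * k'.2.1⁻¹) * (k.2.2 * k'.2.2⁻¹) = 1 := by
  obtain ⟨a, b, c⟩ := k
  obtain ⟨a', b', c'⟩ := k'
  obtain ⟨x, y, z⟩ := g
  simp only [Prod.fst_mul, Prod.snd_mul, mul_inv_rev]
  have h1 : a * x * (x⁻¹ * a'⁻¹) = a * a'⁻¹ := by group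
  have h2 : b * y * (y⁻¹ * b'⁻¹) = b * b'⁻¹ := by group
  have h3 : c * z * (z⁻¹ * c'⁻¹) = c * c'⁻¹ := by group
  rw [h1, h2, h3]

/-- The triple product property says exactly: two related points of `X₀ × X₁ × X₂` are equal.
[cite: CohnUmans2003, Def. 2.1] -/
theorem eq_of_tpp_of_rel {X₀ X₁ X₂ : Finset P} (hTPP : TripleProductProperty X₀ X₁ X₂)
    {x x' : P × P × P} (hx : x.1 ∈ X₀ ∧ x.2.1 ∈ X₁ ∧ x.2.2 ∈ X₂)
    (hx' : x'.1 ∈ X₀ ∧ x'.2.1 ∈ X₁ ∧ x'.2.2 ∈ X₂)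
    (h : x.1 * x'.1⁻¹ * (x.2.1 * x'.2.1⁻¹) * (x.2.2 * x'.2.2⁻¹) = 1) : x = x' := by
  obtain ⟨e₀, e₁, e₂⟩ := hTPP x.1 hx.1 x'.1 hx'.1 x.2.1 hx.2.1 x'.2.1 hx'.2.1 x.2.2 hx.2.2 x'.2.2 hx'.2.2 h
  exact Prod.ext e₀ (Prod.ext e₁ e₂)

/-- **Clique packing in an abstract group.**  Hosts `C₀, C₁, C₂ ⊆ P` closed under `(a, b) ↦ a⁻¹ b`,
`X_i ⊆ C_i` with the triple product property, `K` a finite family of hosted triples pairwise related in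
at least one order.  Then `|X₀||X₁||X₂| · |K| ≤ |C₀||C₁||C₂|`: the map `(k, x) ↦ k⁻¹ x` from
`K × (X₀ × X₁ × X₂)` to `C₀ × C₁ × C₂` is injective by right invariance of the relation and the triple product
property. [folklore] -/
theorem card_mul_card_le_of_tpp_of_clique [DecidableEq P]
    {C₀ C₁ C₂ X₀ X₁ X₂ : Finset P} {K : Finset (P × P × P)}
    (hX₀ : X₀ ⊆ C₀) (hX₁ : X₁ ⊆ C₁) (hX₂ : X₂ ⊆ C₂)
    (hC₀ : ∀ a ∈ C₀, ∀ b ∈ C₀, a⁻¹ * b ∈ C₀) (hC₁ : ∀ a ∈ C₁, ∀ b ∈ C₁, a⁻¹ * b ∈ C₁)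
    (hC₂ : ∀ a ∈ C₂, ∀ b ∈ C₂, a⁻¹ * b ∈ C₂)
    (hTPP : TripleProductProperty X₀ X₁ X₂)
    (hhost : ∀ k ∈ K, k.1 ∈ C₀ ∧ k.2.1 ∈ C₁ ∧ k.2.2 ∈ C₂)
    (hclique : ∀ k ∈ K, ∀ k' ∈ K, k ≠ k' →
      k.1 * k'.1⁻¹ * (k.2.1 * k'.2.1⁻¹) * (k.2.2 * k'.2.2⁻¹) = 1 ∨
      k'.1 * k.1⁻¹ * (k'.2.1 * k.2.1⁻¹) * (k'.2.2 * k.2.2⁻¹) = 1) :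
    X₀.card * X₁.card * X₂.card * K.card ≤ C₀.card * C₁.card * C₂.card := by
  -- the packing map `(k, x) ↦ k⁻¹ x`
  let Φ : (P × P × P) × (P × P × P) → P × P × P := fun d => d.1⁻¹ * d.2
  have hmaps : Set.MapsTo Φ ↑(K ×ˢ (X₀ ×ˢ X₁ ×ˢ X₂)) ↑(C₀ ×ˢ C₁ ×ˢ C₂) := by
    rintro ⟨k, x⟩ hd
    simp only [Finset.coe_product, Set.mem_prod, Finset.mem_coe] at hd
    obtain ⟨hk, hx₀, hx₁, hx₂⟩ := hd
    obtain ⟨h₀, h₁, h₂⟩ := hhost k hk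
    simp only [Φ, Finset.coe_product, Set.mem_prod, Finset.mem_coe, Prod.fst_mul, Prod.snd_mul,
      Prod.fst_inv, Prod.snd_inv]
    exact ⟨hC₀ _ h₀ _ (hX₀ hx₀), hC₁ _ h₁ _ (hX₁ hx₁), hC₂ _ h₂ _ (hX₂ hx₂)⟩
  have hinj : Set.InjOn Φ ↑(K ×ˢ (X₀ ×ˢ X₁ ×ˢ X₂)) := by
    rintro ⟨k, x⟩ hd ⟨k', x'⟩ hd' he
    simp only [Finset.coe_product, Set.mem_prod, Finset.mem_coe] at hd hd'
    obtain ⟨hk, hx⟩ := hd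
    obtain ⟨hk', hx'⟩ := hd'
    simp only [Φ] at he
    -- `x = k g`, `x' = k' g` with `g := k⁻¹ x = k'⁻¹ x'`
    set g := k⁻¹ * x with hg
    have hxg : x = k * g := by rw [hg, mul_inv_cancel_left]
    have hxg' : x' = k' * g := by rw [he, mul_inv_cancel_left]
    by_cases hkk : k = k'
    · subst hkk
      have : x = x' := by rw [hxg, hxg']
      subst this
      rfl
    · exfalso
      have hxx : x = x' := by
        rcases hclique k hk k' hk' hkk with h | h
        · exact eq_of_tpp_of_rel hTPP hx hx' (by rw [hxg, hxg']; exact (rel_mul_right k k' g).2 h)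
        · exact (eq_of_tpp_of_rel hTPP hx' hx (by rw [hxg, hxg']; exact (rel_mul_right k' k g).2 h)).symm
      apply hkk
      have : k * g = k' * g := by rw [← hxg, ← hxg', hxx]
      exact mul_right_cancel this
  have hle := Finset.card_le_card_of_injOn Φ hmaps hinj
  calc X₀.card * X₁.card * X₂.card * K.card
      = (K ×ˢ (X₀ ×ˢ X₁ ×ˢ X₂)).card := by simp only [Finset.card_product]; ring
    _ ≤ (C₀ ×ˢ C₁ ×ˢ C₂).card := hle
    _ = C₀.card * C₁.card * C₂.card := by simp only [Finset.card_product]; ring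

/-- A GROUP of hosted triples with product one is a clique: for `k, k' ∈ T`, `rel k k'` is the
statement that `k k'⁻¹ ∈ T` has product one (this is the relation in the order `(k, k')`).  So `card_mul_card_le_of_tpp_of_clique` contains the group
packing theorem of the sibling line (`…HyperoctahedralSubsets.card_mul_card_le_of_tpp_of_hosted`).
[folklore] -/
theorem clique_of_group {T : Finset (P × P × P)}
    (hmul : ∀ s ∈ T, ∀ t ∈ T, s * t ∈ T) (hinv : ∀ t ∈ T, t⁻¹ ∈ T)
    (hone : ∀ t ∈ T, t.1 * t.2.1 * t.2.2 = 1) :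
    ∀ k ∈ T, ∀ k' ∈ T, k ≠ k' →
      k.1 * k'.1⁻¹ * (k.2.1 * k'.2.1⁻¹) * (k.2.2 * k'.2.2⁻¹) = 1 ∨
      k'.1 * k.1⁻¹ * (k'.2.1 * k.2.1⁻¹) * (k'.2.2 * k.2.2⁻¹) = 1 := by
  intro k hk k' hk' _
  left
  have h := hone _ (hmul _ hk _ (hinv _ hk'))
  simpa only [Prod.fst_mul, Prod.snd_mul, Prod.fst_inv, Prod.snd_inv] using h

/-- **Clique packing inside three centralisers** (hyperoctahedral hosts when the `μ i` are
fixed-point-free involutions, but nothing about `μ` is used).  For permutations `μ₀, μ₁, μ₂` of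
`Fin n`, sets `X_i` of permutations commuting with `μ_i` with the triple product property, and a
finite family `K` of triples `(a, b, c)` with `a μ₀ = μ₀ a`, `b μ₁ = μ₁ b`, `c μ₂ = μ₂ c`, any two
distinct members of which satisfy `a a'⁻¹ (b b'⁻¹) (c c'⁻¹) = 1` in at least one order:
`|X₀||X₁||X₂| · |K| ≤ |C(μ₀)||C(μ₁)||C(μ₂)|`. [folklore] -/
theorem clique_packing (n : ℕ) (μ : Fin 3 → Equiv.Perm (Fin n))
    (X : Fin 3 → Finset (Equiv.Perm (Fin n)))
    (K : Finset (Equiv.Perm (Fin n) × Equiv.Perm (Fin n) × Equiv.Perm (Fin n)))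
    (hX : ∀ i, ∀ σ ∈ X i, σ * μ i = μ i * σ)
    (hTPP : TripleProductProperty (X 0) (X 1) (X 2))
    (hhost : ∀ k ∈ K, k.1 * μ 0 = μ 0 * k.1 ∧ k.2.1 * μ 1 = μ 1 * k.2.1 ∧ k.2.2 * μ 2 = μ 2 * k.2.2)
    (hclique : ∀ k ∈ K, ∀ k' ∈ K, k ≠ k' →
      k.1 * k'.1⁻¹ * (k.2.1 * k'.2.1⁻¹) * (k.2.2 * k'.2.2⁻¹) = 1 ∨
      k'.1 * k.1⁻¹ * (k'.2.1 * k.2.1⁻¹) * (k'.2.2 * k.2.2⁻¹) = 1) :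
    (X 0).card * (X 1).card * (X 2).card * K.card ≤
      (Finset.univ.filter (fun σ : Equiv.Perm (Fin n) => σ * μ 0 = μ 0 * σ)).card *
      (Finset.univ.filter (fun σ : Equiv.Perm (Fin n) => σ * μ 1 = μ 1 * σ)).card *
      (Finset.univ.filter (fun σ : Equiv.Perm (Fin n) => σ * μ 2 = μ 2 * σ)).card := by
  have hsub : ∀ i, X i ⊆ Finset.univ.filter (fun σ : Equiv.Perm (Fin n) => σ * μ i = μ i * σ) :=
    fun i σ hσ => Finset.mem_filter.2 ⟨Finset.mem_univ _, hX i σ hσ⟩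
  refine card_mul_card_le_of_tpp_of_clique (hsub 0) (hsub 1) (hsub 2)
    (HyperoctahedralSubsets.inv_mul_mem_filter_comm (μ 0))
    (HyperoctahedralSubsets.inv_mul_mem_filter_comm (μ 1))
    (HyperoctahedralSubsets.inv_mul_mem_filter_comm (μ 2)) hTPP (fun k hk => ?_) hclique
  obtain ⟨h₀, h₁, h₂⟩ := hhost k hk
  exact ⟨Finset.mem_filter.2 ⟨Finset.mem_univ _, h₀⟩, Finset.mem_filter.2 ⟨Finset.mem_univ _, h₁⟩,
    Finset.mem_filter.2 ⟨Finset.mem_univ _, h₂⟩⟩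

/-- **Volume bound from a clique certificate** (the form a small-`n` certificate file uses): under the
hypotheses of `clique_packing` with `K` non-empty,
`|X₀||X₁||X₂| ≤ |C(μ₀)||C(μ₁)||C(μ₂)| / |K|`. [folklore] -/
theorem vol_le_div_of_clique (n : ℕ) (μ : Fin 3 → Equiv.Perm (Fin n))
    (X : Fin 3 → Finset (Equiv.Perm (Fin n)))
    (K : Finset (Equiv.Perm (Fin n) × Equiv.Perm (Fin n) × Equiv.Perm (Fin n)))
    (hX : ∀ i, ∀ σ ∈ X i, σ * μ i = μ i * σ)
    (hTPP : TripleProductProperty (X 0) (X 1) (X 2))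
    (hhost : ∀ k ∈ K, k.1 * μ 0 = μ 0 * k.1 ∧ k.2.1 * μ 1 = μ 1 * k.2.1 ∧ k.2.2 * μ 2 = μ 2 * k.2.2)
    (hclique : ∀ k ∈ K, ∀ k' ∈ K, k ≠ k' →
      k.1 * k'.1⁻¹ * (k.2.1 * k'.2.1⁻¹) * (k.2.2 * k'.2.2⁻¹) = 1 ∨
      k'.1 * k.1⁻¹ * (k'.2.1 * k.2.1⁻¹) * (k'.2.2 * k.2.2⁻¹) = 1) (hK : K.Nonempty) :
    (X 0).card * (X 1).card * (X 2).card ≤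
      (Finset.univ.filter (fun σ : Equiv.Perm (Fin n) => σ * μ 0 = μ 0 * σ)).card *
      (Finset.univ.filter (fun σ : Equiv.Perm (Fin n) => σ * μ 1 = μ 1 * σ)).card *
      (Finset.univ.filter (fun σ : Equiv.Perm (Fin n) => σ * μ 2 = μ 2 * σ)).card / K.card := by
  have h := clique_packing n μ X K hX hTPP hhost hclique
  exact (Nat.le_div_iff_mul_le (Finset.card_pos.2 hK)).2 h

end CliquePacking

/-- **Stub `stub_cliquePacking` — clique packing inside the three hosts** (crux
`SnSubsetDichotomy.HyperoctahedralThreshold`, stmt-MatrixMultiplication-10883, certificate track of the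
refutation line).  For permutations `μ₀, μ₁, μ₂` of `Fin n`, sets `X_i` of permutations commuting with
`μ_i` and having the triple product property, and a finite family `K` of hosted triples
(`a μ₀ = μ₀ a`, `b μ₁ = μ₁ b`, `c μ₂ = μ₂ c`) any two distinct members `(a,b,c), (a',b',c')` of which
satisfy `a a'⁻¹ (b b'⁻¹) (c c'⁻¹) = 1` in at least one of the two orders:
`|X₀||X₁||X₂| · |K| ≤ |C(μ₀)||C(μ₁)||C(μ₂)|`, `C(μ) = univ.filter (σ μ = μ σ)`.  Immediate from
`CliquePacking.clique_packing`; generalises the sibling line's `stub_groupPacking` (p74548) from groups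
of triples with product one to arbitrary cliques. [folklore] -/
theorem stub_cliquePacking : ∀ (n : ℕ) (μ : Fin 3 → Equiv.Perm (Fin n)) (X : Fin 3 → Finset (Equiv.Perm (Fin n))) (K : Finset (Equiv.Perm (Fin n) × Equiv.Perm (Fin n) × Equiv.Perm (Fin n))), (∀ i, ∀ σ ∈ X i, σ * μ i = μ i * σ) → Literature.Combinatorics.Additive.TripleProductProperty (X 0) (X 1) (X 2) → (∀ k ∈ K, k.1 * μ 0 = μ 0 * k.1 ∧ k.2.1 * μ 1 = μ 1 * k.2.1 ∧ k.2.2 * μ 2 = μ 2 * k.2.2) → (∀ k ∈ K, ∀ k' ∈ K, k ≠ k' → k.1 * k'.1⁻¹ * (k.2.1 * k'.2.1⁻¹) * (k.2.2 * k'.2.2⁻¹) = 1 ∨ k'.1 * k.1⁻¹ * (k'.2.1 * k.2.1⁻¹) * (k'.2.2 * k.2.2⁻¹) = 1) → (X 0).card * (X 1).card * (X 2).card * K.card ≤ (Finset.univ.filter (fun σ : Equiv.Perm (Fin n) => σ * μ 0 = μ 0 * σ)).card * (Finset.univ.filter (fun σ : Equiv.Perm (Fin n) => σ * μ 1 = μ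 1 * σ)).card * (Finset.univ.filter (fun σ : Equiv.Perm (Fin n) => σ * μ 2 = μ 2 * σ)).card := by
  intro n μ X K hX hTPP hhost hclique
  exact CliquePacking.clique_packing n μ X K hX hTPP hhost hclique

end Summit.MatrixMultiplication.MatrixMultiplication.Theorems.HyperoctahedralThreshold
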